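import Literature.NumberTheory.EllipticCurves.AnticyclotomicSignedSelmer
import Literature.NumberTheory.EllipticCurves.LocalTorsionGoodReductionProofs
import Summits.BirchSwinnertonDyer.Rank1Residual.X11b.AnticyclotomicLocalTorsionDescent
import Summits.BirchSwinnertonDyer.BirchSwinnertonDyer.Theorems.UniversalToricDescentTowerNoPTorsion
import Summits.BirchSwinnertonDyer.BirchSwinnertonDyer.Theorems.UniversalToricDescentTwinThreeAdicImageOverK
import HarnessLib

/-!
# Route `UniversalToricDescent`, crux #3 C₀ `TwinSplitIMCAtThreeGoodSSApZero` (stmt-BirchSwinnertonDyer-23594):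
# two named INPUTS of the `⊇`-port DISCHARGED — `E(K_∞)[p] = 0` (Iovita–Pollack 2006 Lemma 2.1) and
# `E(K_{∞,w})[p] = 0` at `w ∣ p` (B.-D. Kim 2013 Prop. 3.2), for every odd good-supersingular `p`

Width seat bsd-wall-utd-p2-w2 (prover, `--supports stmt-BirchSwinnertonDyer-23594`; lead utd-p2 g10, line
`threeframes-apzero`, registered skeleton cdf444518337a285). The `⊇`-half of the crux
(`stub_howardFrameSS_apZero`) is a PORT of Castella–Wan, Math. Ann. 389 (2024) Thm. A.5 + Thm. 6.8 to
`p = 3`, `a₃ = 0`; its carriers were typed by utd-ty1 g0 in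
`Literature/NumberTheory/EllipticCurves/AnticyclotomicSignedSelmer.lean` (p600108) together with FOUR
statement-only named facts. This file PROVES two of them, for EVERY prime in their `Setting` (odd `p`,
good supersingular with `a_p = 0`, `K` imaginary quadratic with `p = 𝔭𝔭′` split, `κ` anticyclotomic,
`p ∤ h_K` — only "odd", "good supersingular" and "split" are used):

* §1 the `Setting` in kernel currency: every prime `v ∋ p` of `K` is of degree one (`p` splits because
  `𝔭′ ≠ 𝔭` are two primes above `p` in a quadratic field), and `E(ℚ_p)[p] = 0` (good, `p ∣ a_p`
  ⟹ `p ∤ a_p − 1`, i.e. `p` is not anomalous; Silverman VII.2.1/VII.3.1/IV.6.1 in the tree's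
  `localTorsion_eq_zero_of_good_of_not_dvd_frobeniusTrace_sub_one`), hence `E(K_v)[p] = 0` at every
  `v ∣ p` (`K_v ≃ ℚ_p`).
* §2 **`iovitaPollack2006_lemma21_noPTorsion_top_holds`**: `E(K_∞)[p] = 0` — indeed
  `E(K̄)[p^∞]^{D_𝔭 ⊓ ker κ} = 0` (`X11b.AcSelmer.fixedPoints_decomp_inf_kerSubgroup_eq_bot`, Greenberg's
  fixed-point principle for the pro-`p` group `D_𝔭/(D_𝔭 ⊓ ker κ)`), and a point fixed by
  `ker κ` is fixed by `D_𝔭 ⊓ ker κ`. Also the `p^∞`-form `E(K_∞)[p^∞] = 0`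
  (`fixedPoints_kerSubgroup_geomPrimaryTorsion_eq_bot_of_setting`), the form Castella–Wan use
  ("`E(K_∞)[p^∞] = 0`, which by [PR00, §1.3.3] implies that the `Λ^ac`-torsion submodule of
  `H¹(K, 𝐓^ac)` is trivial", proof of Thm. 6.8; Lemma A.1).
* §3 **`bdKim2013_prop32_localPoints_noPTorsion_holds`**: `E(K_{∞,w})[p] = 0` at every `v ∣ p`
  (`w` the place of `K_∞` singled out by `closureEmb`): `E(K_∞·K_v) ⊇ ⋃_n E(K_n·K_v)` is killed by
  the local fixed-point principle `UniversalToricDescentTowerTorsion.localTowerPoints_eq_zero_of_prime_nsmul_of_base`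
  fed by `E(K_v)[p] = 0`.

So the port's remaining named inputs in that file are `hatleyLeiVigni2022_prop39_control_base` (signed
control base ↔ top) and `longoVigni2019_thm14_signedSelmerDual_rank_one` (`p ≥ 5` verbatim). HONEST
STATUS: two Literature named facts become theorems (net named-fact debt −2 for the port); nothing of the
crux's three stubs is proved; no definition, no named fact, no `sorry`. BSD is not proved by any of this.

References: [IovitaPollack2006] A. Iovita, R. Pollack, J. reine angew. Math. 598 (2006), Lemma 2.1
(arXiv:math/0411496 p. 5); [BDKim2013] B. D. Kim, J. Aust. Math. Soc. 95 (2013), Prop. 3.2 (p. 193);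
[CastellaWan2023] F. Castella, X. Wan, Math. Ann. 389 (2024), proof of Thm. 6.8 (MS p. 30), Lemma A.1
(MS p. 34); [GreenbergLNM1716] R. Greenberg, LNM 1716 (1999), proof of Prop. 4.8 (p. 109);
[SilvermanAEC2009] VII.2.1, VII.3.1, IV.6.1; [Castella2018Erratum] Lemma 2.1.
-/

set_option autoImplicit false
-- `…BirchSwinnertonDyer.BirchSwinnertonDyer.Theorems…` is the problem's mandated namespace (D-0017).
set_option linter.dupNamespace false

noncomputable section

open scoped Classical

namespace Summit.BirchSwinnertonDyer.BirchSwinnertonDyer.Theorems.UniversalToricDescentSignedSetting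

open NumberField IsDedekindDomain Field WeierstrassCurve
open Literature.NumberTheory.EllipticCurves Literature.NumberTheory.EllipticCurves.Rank1Residual
  Literature.NumberTheory.EllipticCurves.GreenbergSelmer Literature.NumberTheory.EllipticCurves.AcSigned
  Summit.BirchSwinnertonDyer.Rank1Residual.X11b
  Summit.BirchSwinnertonDyer.BirchSwinnertonDyer.Theorems.UniversalToricDescentTowerTorsion

variable (W : WeierstrassCurve ℚ) [W.IsGloballyMinimal] (K : Type) [Field K] [NumberField K]
  (p : ℕ) [Fact p.Prime] (κ : ZpExtension K p) (𝔭 𝔭' : HeightOneSpectrum (𝓞 K))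

/-! ### §1 The `Setting` in kernel currency: degree-one primes above `p`, `E(ℚ_p)[p] = 0`, `E(K_v)[p] = 0` -/

/-- **In the `Setting`, `p` splits in `K`**: `𝔭 ≠ 𝔭′` are two primes above `p` in the quadratic field
`K`, so `#{𝔓 ∣ p} = 2` (`X11b.SplitsIn K p`). [cite: IovitaPollack2006, §2 Hypothesis (S) (arXiv:math/0411496 p. 5)] -/
theorem splitsIn_of_setting (hS : Setting W K p κ 𝔭 𝔭') : SplitsIn K p :=
  ThreeAdicImageOverK.ncard_primesOver_eq_two_of_ne hS.isImaginaryQuadratic.1 Fact.out hS.mem hS.mem'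
    hS.ne

/-- **In the `Setting`, every prime `v ∋ p` of `K` is of degree one** (`e(v|p) = f(v|p) = 1`, so
`K_v ≃ ℚ_p`: Iovita–Pollack "each `K_{𝔭_i} ≅ ℚ_p`"). [cite: IovitaPollack2006, Lemma 2.1 (proof) (arXiv:math/0411496 p. 5)] -/
theorem degreeOne_of_setting (hS : Setting W K p κ 𝔭 𝔭') {v : HeightOneSpectrum (𝓞 K)}
    (hv : ((p : ℕ) : 𝓞 K) ∈ v.asIdeal) :
    v.asIdeal.ramificationIdx (𝓞 ℚ) = 1 ∧ v.asIdeal.inertiaDeg (𝓞 ℚ) = 1 :=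
  degreeOne_of_splitsIn hS.isImaginaryQuadratic.1 (splitsIn_of_setting W K p κ 𝔭 𝔭' hS) hv

/-- **In the `Setting`, `E(ℚ_p)[p] = 0`**: `p ≥ 3` is good and `p ∣ a_p`, so `p ∤ a_p − 1` (`p` is
not anomalous: `#Ẽ(𝔽_p) = p + 1 − a_p ≡ 1 (mod p)`) and `Ê(pℤ_p)` has no `p`-torsion (Silverman
VII.2.1, VII.3.1, IV.6.1; tree `localTorsion_eq_zero_of_good_of_not_dvd_frobeniusTrace_sub_one`).
[cite: IovitaPollack2006, Lemma 2.1 (proof: "`Ẽ(𝔽_p)` and `Ê(ℚ_p)` have no `p`-torsion") (arXiv:math/0411496 p. 5)]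
[cite: SilvermanAEC2009, VII.2 Prop. 2.1, VII.3 Prop. 3.1, IV.6 Thm. 6.1] -/
theorem noPTorsion_padic_of_setting (hS : Setting W K p κ 𝔭 𝔭') :
    haveI := hS.isElliptic
    ∀ R : (W.baseChange ℚ_[p]).toAffine.Point, p • R = 0 → R = 0 := by
  haveI := hS.isElliptic
  have hp : p.Prime := Fact.out
  have hp3 : 3 ≤ p := by
    have h2 := hp.two_le
    have hne := hS.p_ne_two
    omega
  refine localTorsion_eq_zero_of_good_of_not_dvd_frobeniusTrace_sub_one W p hp3 hS.goodSS.1 ?_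
  intro hdvd
  have h1 : (p : ℤ) ∣ 1 := by
    have h := dvd_sub hS.goodSS.2 hdvd
    rwa [sub_sub_cancel] at h
  have hp1 : p ∣ 1 := by exact_mod_cast h1
  exact hp.one_lt.ne' (Nat.dvd_one.mp hp1)

/-- **In the `Setting`, `E(K_v)[p] = 0` at every `v ∋ p`** (transport of `E(ℚ_p)[p] = 0` along a ring
map `K_v → ℚ_p`, which exists because `v` is of degree one). [cite: IovitaPollack2006, Lemma 2.1 ("`E(K_{𝔭_i})[p] = 0`") (arXiv:math/0411496 p. 5)] -/
theorem noPTorsion_adicCompletion_of_setting (hS : Setting W K p κ 𝔭 𝔭') {v : HeightOneSpectrum (𝓞 K)}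
    (hv : ((p : ℕ) : 𝓞 K) ∈ v.asIdeal) :
    ∀ R : ((W.baseChange K).baseChange (v.adicCompletion K)).toAffine.Point, p • R = 0 → R = 0 := by
  haveI := hS.isElliptic
  obtain ⟨he, hf⟩ := degreeOne_of_setting W K p κ 𝔭 𝔭' hS hv
  obtain ⟨e⟩ := AcSelmer.exists_ringHom_adicCompletion_padic_of_degreeOne p v hv he hf
  exact AcSelmer.noPTorsion_baseChange_adicCompletion_of_padic W p v e
    (noPTorsion_padic_of_setting W K p κ 𝔭 𝔭' hS)

/-! ### §2 `E(K_∞)[p^∞] = 0` — Iovita–Pollack 2006 Lemma 2.1 (global half) PROVED -/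

/-- **`E(K̄)[p^∞]^{D_𝔭 ⊓ ker κ} = 0` in the `Setting`** — no non-zero `p`-power torsion point of `E`
over `K̄` is fixed by the decomposition group of `K_∞` at the place above `𝔭` singled out by the chosen
embedding (Galois descent to `E(K_𝔭)`, tree `X11b.AcSelmer.eq_zero_of_fixed_decomp_of_local`, then
the pro-`p` fixed-point principle `X11b.AcSelmer.fixedPoints_decomp_inf_kerSubgroup_eq_bot`, fed by
`E(K_𝔭)[p] = 0` at the degree-one prime `𝔭`). [cite: GreenbergLNM1716, proof of Prop. 4.8 (p. 109)] [cite: Castella2018Erratum, Lemma 2.1 (pp. 1–2)] -/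
theorem fixedPoints_decomp_inf_kerSubgroup_geomPrimaryTorsion_eq_bot_of_setting
    (hS : Setting W K p κ 𝔭 𝔭') :
    FixedPoints.addSubgroup ↥(decomp 𝔭 ⊓ κ.kerSubgroup) ((W.baseChange K).geomPrimaryTorsion p) = ⊥ := by
  haveI := hS.isElliptic
  have hKv := noPTorsion_adicCompletion_of_setting W K p κ 𝔭 𝔭' hS hS.mem
  exact AcSelmer.fixedPoints_decomp_inf_kerSubgroup_eq_bot κ (W.baseChange K) 𝔭 fun m hfix hpm ↦
    AcSelmer.eq_zero_of_fixed_decomp_of_local (W.baseChange K) p 𝔭 hKv m hfix hpm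

/-- **`E(K_∞)[p^∞] = 0` in the `Setting`**: the subgroup of `E(K̄)[p^∞]` fixed by
`Gal(K̄/K_∞) = ker κ` is trivial (a point fixed by `ker κ` is fixed by `D_𝔭 ⊓ ker κ`). This is the
form Castella–Wan use: "`E(K_∞)[p^∞] = 0`, which by [PR00, §1.3.3] implies that the `Λ^ac`-torsion
submodule of `H¹(K, 𝐓^ac)` is trivial". [cite: IovitaPollack2006, Lemma 2.1 (arXiv:math/0411496 p. 5)]
[cite: CastellaWan2023, proof of Thm. 6.8 (MS p. 30) and Lemma A.1 (MS p. 34)] -/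
theorem fixedPoints_kerSubgroup_geomPrimaryTorsion_eq_bot_of_setting (hS : Setting W K p κ 𝔭 𝔭') :
    FixedPoints.addSubgroup ↥κ.kerSubgroup ((W.baseChange K).geomPrimaryTorsion p) = ⊥ := by
  rw [eq_bot_iff]
  intro m hm
  have h := fixedPoints_decomp_inf_kerSubgroup_geomPrimaryTorsion_eq_bot_of_setting W K p κ 𝔭 𝔭' hS
  have hmem : m ∈ FixedPoints.addSubgroup ↥(decomp 𝔭 ⊓ κ.kerSubgroup)
      ((W.baseChange K).geomPrimaryTorsion p) := by
    refine (FixedPoints.mem_addSubgroup _ _ m).mpr fun d ↦ ?_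
    have hd : (d : absoluteGaloisGroup K) ∈ κ.kerSubgroup := (Subgroup.mem_inf.mp d.2).2
    exact (FixedPoints.mem_addSubgroup _ _ m).mp hm ⟨(d : absoluteGaloisGroup K), hd⟩
  rw [h] at hmem
  exact hmem

/-- **Iovita–Pollack 2006, Lemma 2.1 (global half), PROVED for every prime of its `Setting`:
`E(K_∞)[p] = 0`** — the named fact `AcSigned.iovitaPollack2006_lemma21_noPTorsion_top` of the
`⊇`-port's carrier file is a theorem: a point `P ∈ E(K̄)` fixed by `Gal(K̄/K_∞) = ker κ` with `p • P = O`
lies in `E(K̄)[p^∞]^{ker κ} = 0`. [cite: IovitaPollack2006, Lemma 2.1 (arXiv:math/0411496 p. 5)]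
[cite: CastellaWan2023, proof of Thm. 6.8 (MS p. 30) and Lemma A.1 (MS p. 34)] -/
theorem iovitaPollack2006_lemma21_noPTorsion_top_holds :
    iovitaPollack2006_lemma21_noPTorsion_top W K p κ 𝔭 𝔭' := by
  intro hS P hfix hpP
  -- `P` as an element of `E(K̄)[p^∞]`
  have hPmem : P ∈ (W.baseChange K).geomPrimaryTorsion p :=
    (AddCommGroup.mem_primaryComponent).mpr ⟨1, by rw [pow_one]; exact hpP⟩
  set m : (W.baseChange K).geomPrimaryTorsion p := ⟨P, hPmem⟩ with hmdef
  have hm : m ∈ FixedPoints.addSubgroup ↥κ.kerSubgroup ((W.baseChange K).geomPrimaryTorsion p) := by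
    refine (FixedPoints.mem_addSubgroup _ _ m).mpr fun τ ↦ Subtype.ext ?_
    exact hfix τ τ.2
  rw [fixedPoints_kerSubgroup_geomPrimaryTorsion_eq_bot_of_setting W K p κ 𝔭 𝔭' hS,
    AddSubgroup.mem_bot] at hm
  exact congrArg Subtype.val hm

/-! ### §3 `E(K_{∞,w})[p] = 0` at `w ∣ p` — B.-D. Kim 2013 Prop. 3.2 PROVED -/

/-- `⋃_n E(K_n·E) ⊆ E(K_∞·E)`: the carrier file's `localPointsInfty` (the `⨆` of the layer groups) lies
in Sprung's tower points (the points fixed by `Gal(Ē/K_∞·E)`), for any base field, any `ℤ_p`-extension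
and any embedding. [cite: IovitaPollack2006, §2.1 (arXiv:math/0411496 p. 5)] [cite: Sprung2012, Lemma 7.10 (p. 1503)] -/
theorem localPointsInfty_le_localTowerPointsOfEmb {F : Type} [Field F] (κ' : ZpExtension F p)
    {E : Type} [Field E] [Algebra F E] (ι : AlgebraicClosure F →ₐ[F] AlgebraicClosure E)
    (V : WeierstrassCurve F) :
    localPointsInfty κ' ι V ≤ Sprung2012.localTowerPointsOfEmb κ' ι V :=
  iSup_le fun n ↦ Sprung2012.localLayerPointsOfEmb_le_localTowerPointsOfEmb κ' ι V n

/-- **B.-D. Kim 2013, Prop. 3.2 (= Iovita–Pollack Lemma 2.1, local half; Kobayashi 2003 Prop. 8.7),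
PROVED for every prime of its `Setting`: `E(K_{∞,w})[p] = 0` at every `v ∣ p`** — the named fact
`AcSigned.bdKim2013_prop32_localPoints_noPTorsion` of the `⊇`-port's carrier file is a theorem: the
points of `E` over the local tower `K_∞·K_v = ⋃_n K_n·K_v` (place singled out by `closureEmb`) killed
by `p` vanish, by the local fixed-point principle
(`UniversalToricDescentTowerTorsion.localTowerPoints_eq_zero_of_prime_nsmul_of_base`) fed by
`E(K_v)[p] = 0` (§1). [cite: BDKim2013, Prop. 3.2 (p. 193)] [cite: IovitaPollack2006, Lemma 2.1 (arXiv:math/0411496 p. 5)]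
[cite: GreenbergLNM1716, proof of Prop. 4.8 (p. 109)] -/
theorem bdKim2013_prop32_localPoints_noPTorsion_holds :
    bdKim2013_prop32_localPoints_noPTorsion W K p κ 𝔭 𝔭' := by
  intro hS v hv P hP hpP
  haveI := hS.isElliptic
  haveI : CharZero (v.adicCompletion K) :=
    charZero_of_injective_algebraMap (algebraMap K (v.adicCompletion K)).injective
  exact localTowerPoints_eq_zero_of_prime_nsmul_of_base κ (closureEmb (K := K) (v.adicCompletion K))
    (W.baseChange K) (noPTorsion_adicCompletion_of_setting W K p κ 𝔭 𝔭' hS hv)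
    (localPointsInfty_le_localTowerPointsOfEmb p κ _ (W.baseChange K) hP) hpP

end Summit.BirchSwinnertonDyer.BirchSwinnertonDyer.Theorems.UniversalToricDescentSignedSetting

end
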